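import Mathlib.FieldTheory.Galois.Infinite
import Mathlib.FieldTheory.Galois.Profinite
import Mathlib.LinearAlgebra.LinearIndependent.Basic
import Mathlib.Topology.Algebra.ClopenNhdofOne
import HarnessLib

/-!
# Hilbert's Theorem 90 for CONTINUOUS cocycles of a subgroup of an infinite Galois group
# (`H¹(G_L, K̄^×) = 0` for every algebraic extension `L`, Noether's argument run on a finite layer)

HONEST FRAMING (cell `b2b-bsdres`, run/shared/lean/b2b/bsd-rank1-residual/, verbatim in every
file): the goal of the cell is to DELETE the COMBINATION-SHAPED residual classes of the
Birch–Swinnerton-Dyer formula for ALL analytic-rank `≤ 1` elliptic curves over `ℚ` — "full BSD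
formula for every rank `≤ 1` curve in class `C`" assembled STRICTLY from published theorems — so
that the rank-`≤ 1` remainder becomes exactly the CONSTRUCTION-SHAPED classes, which are TYPED
(missing-input `Prop`s), NOT attempted. This is not "finishing BSD". Sub-cell
`b2b-bsdres-eisenstein-p2` (CLASS-OWNERS row "X2"), gen 12: research route; NO CLAIM BEYOND STATED
CLASSES; nothing here changes a label. THEOREMS ONLY (pure field theory over Mathlib; no `def`,
no named fact).

WHY. Greenberg (LNM 1716, §2 p. 76) on `Im(κ_K) = Im(λ_K)` at a multiplicative prime: "the equality
… can be verified quite directly by using the Tate parametrization for `E`." Through the Tate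
parametrisation `K̄_v^×/q^ℤ ≅ E(K̄_v)` a class satisfying the strict Greenberg condition becomes a
continuous `1`-cocycle of `G_K = Gal(K̄_v/K)` with values in the roots of unity of `K̄_v^×`, and
the Kummer condition asks for it to be a coboundary in `K̄_v^×` — Hilbert's Theorem 90 for the
profinite group `G_K`. Mathlib has Noether's `H¹(Gal(L/K), L^×) = 0` for FINITE extensions
(`groupCohomology.isMulCoboundary₁_of_isMulCocycle₁_of_aut_to_units`); THIS FILE proves the
continuous version the cell needs (the sibling `GreenbergVatsalKummerStrictTate` applies it to
DISCHARGE the cell's named fact `Greenberg1999.imKummer_ge_strictCondition_multiplicative`):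

**`exists_mul_apply_eq_of_cocycle`** — `K/k` Galois (any degree), `G₀ ≤ Gal(K/k)` ANY subgroup,
`c : G₀ → K^×` with `c(gh) = g(c h)·c(g)` and `{c = 1}` open in `G₀` (continuity for the Krull
topology and the discrete `K^×`): there is `β ≠ 0` with `c(g)·g(β) = β` for all `g ∈ G₀`
(`c(g) = g(β⁻¹)/β⁻¹`). Proof (Noether/Speiser on a finite layer, Serre *Local Fields* X §1
Prop. 2): an open normal `U ⊴ Gal(K/k)` with `c = 1` on `G₀ ∩ U` (profinite basis); `c` is then
constant on the cosets `g(G₀ ∩ U)`, which inject into the FINITE set `Gal/U`; for representatives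
`g_q` the characters `x ↦ g_q(x)` of the fixed field `K^U` are pairwise distinct
(`fixingSubgroup (fixedField U) = U`, Mathlib's infinite Galois correspondence for the closed `U`),
so by Dedekind's independence (`linearIndependent_monoidHom`) `β = Σ_q c(g_q)·g_q(z) ≠ 0` for some
`z ∈ K^U`; the cocycle identity gives `g(β) = c(g)⁻¹β`.

References: Serre, *Local Fields* X §1 Prop. 2 and *Galois Cohomology* II §1.2 Prop. 1
(`H¹(G_K, K̄_s^×) = 0`); E. Noether 1933 / Speiser 1919; Greenberg, LNM 1716 (1999) §2 p. 76.
-/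

noncomputable section

open scoped Classical Pointwise

namespace Summit.BirchSwinnertonDyer.Rank1Residual.X2.ContinuousHilbert90

variable {k K : Type*} [Field k] [Field K] [Algebra k K]

/-- A cocycle `c(gh) = g(c h)·c(g)` with nonzero values has `c(1) = 1`. [folklore] -/
theorem cocycle_apply_one (G₀ : Subgroup Gal(K/k)) (c : G₀ → K) (hc0 : ∀ g, c g ≠ 0)
    (hc : ∀ g h : G₀, c (g * h) = (g : Gal(K/k)) (c h) * c g) : c 1 = 1 := by
  have h := hc 1 1
  rw [mul_one, OneMemClass.coe_one, AlgEquiv.one_apply] at h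
  exact (mul_eq_right₀ (hc0 1)).mp h.symm

/-- A cocycle is multiplied trivially on the right by elements where it is `1` and which it…:
`c(gu) = c(g)` when `c(u) = 1`. [folklore] -/
theorem cocycle_mul_of_apply_eq_one (G₀ : Subgroup Gal(K/k)) (c : G₀ → K)
    (hc : ∀ g h : G₀, c (g * h) = (g : Gal(K/k)) (c h) * c g) {g u : G₀} (hu : c u = 1) :
    c (g * u) = c g := by
  rw [hc, hu, map_one, one_mul]

/-- **Hilbert's Theorem 90 for continuous cocycles of a subgroup of `Gal(K/k)`** (`K/k` Galois of
any degree; `G₀` ANY subgroup — for `G₀ = Gal(K/L)` closed this is `H¹(G_L, K^×) = 0`): a map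
`c : G₀ → K^×` with `c(gh) = g(c h)·c(g)` whose unit level set `{c = 1}` is open in `G₀` admits
`β ∈ K^×` with `c(g)·g(β) = β` for every `g ∈ G₀`, i.e. `c` is the coboundary of `β⁻¹`. Noether's
argument on the finite layer `K^U/K^{G₀U}` cut out by an open normal subgroup `U` on which `c`
dies. [cite: SerreLocalFields1979, Ch. X §1 Prop. 2] [cite: SerreGaloisCohomology1997, II §1.2 Prop. 1] -/
theorem exists_mul_apply_eq_of_cocycle [IsGalois k K] (G₀ : Subgroup Gal(K/k)) (c : G₀ → K)
    (hc0 : ∀ g, c g ≠ 0) (hc : ∀ g h : G₀, c (g * h) = (g : Gal(K/k)) (c h) * c g)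
    (hopen : IsOpen {g : G₀ | c g = 1}) :
    ∃ β : K, β ≠ 0 ∧ ∀ g : G₀, c g * (g : Gal(K/k)) β = β := by
  have h1 : c 1 = 1 := cocycle_apply_one G₀ c hc0 hc
  -- Step 1: an open normal subgroup `U` of `Gal(K/k)` with `c = 1` on `G₀ ∩ U`
  obtain ⟨O, hO, hOeq⟩ := isOpen_induced_iff.mp hopen
  have h1O : (1 : Gal(K/k)) ∈ O := by
    have : (1 : G₀) ∈ Subtype.val ⁻¹' O := by rw [hOeq]; exact h1
    exact this
  obtain ⟨U, hUO⟩ := ProfiniteGrp.exist_openNormalSubgroup_sub_open_nhds_of_one hO h1O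
  have hcU : ∀ g : G₀, (g : Gal(K/k)) ∈ (U : Set Gal(K/k)) → c g = 1 := fun g hg ↦ by
    have : g ∈ Subtype.val ⁻¹' O := hUO hg
    rw [hOeq] at this
    exact this
  -- the Galois correspondence for the closed subgroup `U`
  have hUfix : (IntermediateField.fixedField (U : Subgroup Gal(K/k))).fixingSubgroup =
      (U : Subgroup Gal(K/k)) :=
    InfiniteGalois.fixingSubgroup_fixedField
      (⟨(U : Subgroup Gal(K/k)), U.toOpenSubgroup.isClosed⟩ : ClosedSubgroup Gal(K/k))
  set M' := IntermediateField.fixedField (U : Subgroup Gal(K/k)) with hM'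
  -- Step 2: the classes of `Gal/U` meeting `G₀`, with representatives in `G₀`
  haveI : Finite (Gal(K/k) ⧸ (U : Subgroup Gal(K/k))) :=
    Subgroup.quotient_finite_of_isOpen _ U.isOpen
  haveI : Fintype (Gal(K/k) ⧸ (U : Subgroup Gal(K/k))) := Fintype.ofFinite _
  set S : Finset (Gal(K/k) ⧸ (U : Subgroup Gal(K/k))) :=
    Finset.univ.filter (fun q ↦ ∃ g : G₀, (QuotientGroup.mk (g : Gal(K/k)) : _) = q) with hS
  have hmemS : ∀ q, q ∈ S ↔ ∃ g : G₀, (QuotientGroup.mk (g : Gal(K/k)) : _) = q := fun q ↦ by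
    rw [hS, Finset.mem_filter]; exact ⟨fun h ↦ h.2, fun h ↦ ⟨Finset.mem_univ _, h⟩⟩
  have hrep' : ∀ q, ∃ g : G₀, q ∈ S → (QuotientGroup.mk (g : Gal(K/k)) : _) = q := fun q ↦ by
    by_cases hq : q ∈ S
    · obtain ⟨g, hg⟩ := (hmemS q).1 hq; exact ⟨g, fun _ ↦ hg⟩
    · exact ⟨1, fun h ↦ absurd h hq⟩
  choose rep hrep using hrep'
  have hmkS : ∀ g : G₀, (QuotientGroup.mk (g : Gal(K/k)) : Gal(K/k) ⧸ (U : Subgroup Gal(K/k))) ∈ S :=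
    fun g ↦ (hmemS _).2 ⟨g, rfl⟩
  -- `g • q ∈ S` for `g ∈ G₀`, `q ∈ S`
  have hsmulS : ∀ (g : G₀) {q}, q ∈ S → (g : Gal(K/k)) • q ∈ S := fun g q hq ↦ by
    obtain ⟨r, hr⟩ := (hmemS q).1 hq
    rw [← hr, MulAction.Quotient.smul_mk]
    exact (hmemS _).2 ⟨g * r, rfl⟩
  -- the representative of `g • q` differs from `g * rep q` by an element of `G₀ ∩ U`
  have hkey : ∀ (g : G₀) {q} (hq : q ∈ S),
      c (rep ((g : Gal(K/k)) • q)) = (g : Gal(K/k)) (c (rep q)) * c g ∧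
      ∀ z ∈ M', (rep ((g : Gal(K/k)) • q) : Gal(K/k)) z = (g : Gal(K/k)) ((rep q : Gal(K/k)) z) := by
    intro g q hq
    have hq' := hsmulS g hq
    have e1 := hrep _ hq'
    have e2 := hrep _ hq
    -- `(g * rep q)⁻¹ * rep (g • q) ∈ U`
    have hu : (((g * rep q)⁻¹ * rep ((g : Gal(K/k)) • q) : G₀) : Gal(K/k)) ∈
        (U : Set Gal(K/k)) := by
      have : (QuotientGroup.mk ((g * rep q : G₀) : Gal(K/k)) : Gal(K/k) ⧸ (U : Subgroup Gal(K/k))) =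
          QuotientGroup.mk ((rep ((g : Gal(K/k)) • q) : G₀) : Gal(K/k)) := by
        rw [e1, Subgroup.coe_mul]
        conv_rhs => rw [← e2]
        rw [MulAction.Quotient.smul_mk, smul_eq_mul]
      exact QuotientGroup.eq.mp this
    have hcu : c ((g * rep q)⁻¹ * rep ((g : Gal(K/k)) • q)) = 1 := hcU _ hu
    have hdec : rep ((g : Gal(K/k)) • q) = (g * rep q) * ((g * rep q)⁻¹ * rep ((g : Gal(K/k)) • q)) := by
      group
    refine ⟨?_, fun z hz ↦ ?_⟩
    · rw [hdec, cocycle_mul_of_apply_eq_one G₀ c hc hcu, hc]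
    · have hfix : ((((g * rep q)⁻¹ * rep ((g : Gal(K/k)) • q) : G₀)) : Gal(K/k)) z = z :=
        (IntermediateField.mem_fixedField_iff (U : Subgroup Gal(K/k)) z).1 hz _ hu
      conv_lhs => rw [hdec]
      rw [Subgroup.coe_mul, AlgEquiv.mul_apply, hfix, Subgroup.coe_mul, AlgEquiv.mul_apply]
  -- Step 3: Dedekind — the characters `x ↦ rep q (x)` of `M'` are pairwise distinct on `S`
  set χ : (Gal(K/k) ⧸ (U : Subgroup Gal(K/k))) → ((M' : IntermediateField k K) →* K) :=
    fun q ↦ ((rep q : Gal(K/k)) : K →+* K).toMonoidHom.comp (algebraMap M' K).toMonoidHom with hχ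
  have hχ_apply : ∀ q (x : M'), χ q x = (rep q : Gal(K/k)) (x : K) := fun q x ↦ rfl
  have hχinj : ∀ q₁ ∈ S, ∀ q₂ ∈ S, χ q₁ = χ q₂ → q₁ = q₂ := by
    intro q₁ hq₁ q₂ hq₂ h
    have hmem : ((rep q₂ : Gal(K/k)))⁻¹ * (rep q₁ : Gal(K/k)) ∈ (U : Subgroup Gal(K/k)) := by
      rw [← hUfix, IntermediateField.mem_fixingSubgroup_iff]
      intro x hx
      have hx' := congrArg (fun f : (M' →* K) ↦ f ⟨x, hx⟩) h
      simp only [hχ_apply] at hx'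
      rw [AlgEquiv.mul_apply, hx', ← AlgEquiv.mul_apply, inv_mul_cancel, AlgEquiv.one_apply]
    rw [← hrep q₁ hq₁, ← hrep q₂ hq₂]
    exact (QuotientGroup.eq.mpr hmem).symm
  -- hence `β(z) = Σ_{q ∈ S} c(rep q)·rep q(z)` is not identically zero on `M'`
  have hne : ∃ z : M', ∑ q ∈ S, c (rep q) * (rep q : Gal(K/k)) (z : K) ≠ 0 := by
    by_contra hall
    have hall' : ∀ z : M', ∑ q ∈ S, c (rep q) * (rep q : Gal(K/k)) (z : K) = 0 := fun z ↦
      not_not.mp (not_exists.mp hall z)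
    have hli := (linearIndependent_monoidHom M' K).comp
      (fun q : S ↦ χ q) (fun a b hab ↦ Subtype.ext (hχinj a a.2 b b.2 hab))
    have hsum : ∑ q : S, c (rep q) • ((χ q : M' →* K) : M' → K) = 0 := by
      funext z
      rw [Finset.sum_apply, Pi.zero_apply]
      simp only [Pi.smul_apply, smul_eq_mul, hχ_apply]
      rw [Finset.sum_coe_sort S (fun q ↦ c (rep q) * (rep q : Gal(K/k)) (z : K))]
      exact hall' z
    have h0 := (Fintype.linearIndependent_iff.mp hli) (fun q : S ↦ c (rep q)) hsum
      ⟨_, hmkS 1⟩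
    exact hc0 _ h0
  obtain ⟨z, hz⟩ := hne
  refine ⟨∑ q ∈ S, c (rep q) * (rep q : Gal(K/k)) (z : K), hz, fun g ↦ ?_⟩
  -- Step 4: `g β = c(g)⁻¹ β` by reindexing `q ↦ g • q`
  rw [map_sum, Finset.mul_sum]
  refine Finset.sum_bij (fun q _ ↦ (g : Gal(K/k)) • q) (fun q hq ↦ hsmulS g hq)
    (fun q₁ _ q₂ _ h ↦ smul_left_cancel _ h) (fun q hq ↦ ⟨(g : Gal(K/k))⁻¹ • q,
      by simpa using hsmulS g⁻¹ hq, smul_inv_smul _ _⟩) (fun q hq ↦ ?_)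
  obtain ⟨hc', hz'⟩ := hkey g hq
  rw [hc', hz' z z.2, map_mul]
  ring

end Summit.BirchSwinnertonDyer.Rank1Residual.X2.ContinuousHilbert90

end
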